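import Summits.BirchSwinnertonDyer.BirchSwinnertonDyer.Theorems.AlignedTransportAtTwoMainConjectureOfRankZeroBSDAtTwoFineRoadArchKernel
import Summits.BirchSwinnertonDyer.BirchSwinnertonDyer.Theorems.ThetaPartnerAtTwoSignedControlAtTwoH1SigmaRankOne
import Literature.NumberTheory.EllipticCurves.H1SigmaDualFiniteProofs
import Literature.NumberTheory.EllipticCurves.IwasawaNakayamaProofs
import Literature.NumberTheory.EllipticCurves.IwasawaSelmerDualUniquenessProofs
import Mathlib.Algebra.Module.CharacterModule
import HarnessLib

/-!
# Road (b″) of crux C2 `MainConjectureOfRankZeroBSDAtTwo` (stmt-BirchSwinnertonDyer-22298), line `birth`: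
# the ARCHIMEDEAN RECEPTACLE — the relaxed-at-`∞` Selmer dual `X^{rel ∞}(E/ℚ_∞)` at `p = 2` is a finitely
# generated `Λ`-module, EXISTS canonically, and maps `Λ`-linearly ONTO every `X(E/ℚ_∞)`

HONEST FRAMING (cell `bsd-f1-sign2`, HOME `run/shared/lean/pub/bsd-f1-sign2/`, attach seat `bsd-line-att-p4` g5 of
route `AlignedTransportAtTwo`; BSD is NOT proved by any of this; the crux C2 stays OPEN — six lead generations:
`blocked-on: Rank1Residual.GreenbergMuConjectureIrreducible`). THEOREMS ONLY (no `def`, no named fact, nothing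
asserted); `--supports stmt-BirchSwinnertonDyer-22298`, C2-NEUTRAL (road (b″) ends at the OPEN stub PFμ⁺).

WHAT. The netted Kato data `KatoNetDataRelAtTwo` displayed in the crux skeleton (`Cruxes/…/Lines/birth.lean` v9) asks,
among its `∃`-over-Types witnesses, for a `Λ`-module `Xr` pinned to the RELAXED-at-`∞` Selmer group
`Sel^{rel ∞}(ℚ_∞, E[2^∞]) = Greenberg1999.relaxedSelmerInftyAtTwo W κ` and an «archimedean extension» `q : Xr ↠ D.X`
with `e ≤ ℓ₍₂₎(ker q)`; the sibling file `…FineRoadArchKernel` (att-p4 g4) proved `1 ≤ ℓ₍₂₎(ker q)` for `Δ_W > 0`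
GRANTED Greenberg's Lemma 4.6 at `2` (`Greenberg1999.lemma46_relaxed_mod_selmer_infinite_rat_two`, typer p608868) for
ANY finitely generated pinned `Xr` and ANY compatible `Λ`-linear `q`. This file removes the remaining `∃`-data and the
finite-generation hypothesis:

* §1 `Sel^{rel ∞}(ℚ_∞)` is stable under every `conj_τ` (`conjH1_mem_relaxedSelmerInftyAtTwo`), lies in
  `H¹(ℚ_Σ/ℚ_∞, E[2^∞])` for `Σ = {2, bad, ∞}` (`relaxedSelmerInftyAtTwo_le_unramifiedOutside`: the Kummer condition at a
  good odd place is «unramified», Silverman X.4.4 = tree `X2.GreenbergVatsalSelmerLink.localKerOver_le_unramKer`), and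
  **`Sel^{rel ∞}(ℚ_∞)[𝔪] = {s | 2s = 0, conj_γ s = s}` is FINITE** (`finite_setOf_relaxed_twoTorsion_conjH1_eq`, from the
  tree's `finite_setOf_unramifiedOutside_pTorsion_conjH1_eq`, Greenberg LNM 1716 p. 117 / §1 p. 60);
* §2 **every pinned dual `Xr ≅ Hom(Sel^{rel ∞}(ℚ_∞), ℚ/ℤ)` (additive bijection + the two `Λ`-compatibilities) is a
  FINITELY GENERATED `Λ`-module** (`module_finite_of_pinned`: dual Nakayama `IwasawaDual.IsDualPair.module_finite`,
  Lang Ch. 5 §1), and such a pinned `Xr` EXISTS (`exists_pinned_relaxedDual`, the character group with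
  `IwasawaDual.IsLocNil.module`);
* §3 for EVERY pinned `Xr` and EVERY `D : W.SelmerDualData κ γ` the archimedean extension `q : Xr → D.X` — the `Λ`-linear
  map dual to `Sel ≤ Sel^{rel ∞}` — EXISTS (`exists_archExtension`, via the tree's
  `SignedEC.H1SigmaRank.exists_linearMap_selmerDualData_surjective` and `SelmerDualData.exists_linearEquiv`), is UNIQUE
  (`archExtension_unique`), is ONTO (`archExtension_surjective`, Baer), and `2 · ker q = 0`;
* §4 the archimedean conjunct of `KatoNetDataRelAtTwo` ASSEMBLED on the receptacle: `Δ_W < 0` ⇒ `q` bijective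
  (`archExtension_bijective_of_Δ_neg`, unconditional); `Δ_W > 0` ⇒ `1 ≤ ℓ₍₂₎(ker q)` with NO finite-generation
  hypothesis left (`one_le_lengthAt_ker_archExtension'`, modulo the PRINT fact p608868 only); packaged existence
  `exists_archReceptacle` (`∃ Xr toDualR q`, pinned ∧ f.g. ∧ compatible ∧ onto ∧ `[0 < Δ_W] ≤ ℓ₍₂₎(ker q)`).

NOT here (not typable today): the descent / fine-comparison instantiations of the sibling files `…FineRoadDescentKernel`,
`…FineRoadFineKernel` — they need Selmer / fine-Selmer receptacles over `ker χ₂` (duals over `ℚ(ζ_{2^∞})`), which the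
tree does not define.

References: R. Greenberg, LNM 1716 (1999), §1 p. 60, §4 Lemma 4.6 and Remark (pp. 105–107), p. 117; S. Lang,
*Cyclotomic Fields I–II*, Ch. 5 §1; J. Silverman, AEC, X.4.3–4.4; L. Washington, GTM 83, §13.2.
-/

set_option autoImplicit false
-- the Theorems namespace of this sub repeats the summit name by design (D-0017 nested layout)
set_option linter.dupNamespace false

noncomputable section

open scoped Classical

namespace Summit.BirchSwinnertonDyer.BirchSwinnertonDyer.Theorems.AlignedTransportAtTwoFineRoad.ArchReceptacle

open NumberField IsDedekindDomain Field WeierstrassCurve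
open Literature.NumberTheory.EllipticCurves Literature.NumberTheory.EllipticCurves.IwasawaAlgebra
  Literature.NumberTheory.EllipticCurves.Module Literature.NumberTheory.EllipticCurves.Greenberg1999
  Literature.NumberTheory.EllipticCurves.GreenbergVatsal2000
  Literature.NumberTheory.GaloisRepresentations ZpExtension

universe v

variable (W : WeierstrassCurve ℚ) [W.IsElliptic] (κ : ZpExtension ℚ 2) {γ : Field.absoluteGaloisGroup ℚ}

/-! ## §1 `Sel^{rel ∞}(ℚ_∞, E[2^∞])`: `conj`-stability, unramified outside `2·N_E`, finiteness of `Sel^{rel ∞}[𝔪]` -/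

omit [W.IsElliptic] in
/-- `Sel^{rel ∞}(ℚ_∞, E[2^∞])` is stable under `conj_τ` for EVERY `τ ∈ Γ_ℚ` (it is an intersection over all
conjugates of the finite-place Kummer conditions; `conj_σ ∘ conj_τ = conj_{στ}`).
[cite: GreenbergLNM1716, §1 (after Conj. 1.3) and §4 p. 106] -/
theorem conjH1_mem_relaxedSelmerInftyAtTwo (τ : Field.absoluteGaloisGroup ℚ) {c : W.subgroupH1 2 κ.kerSubgroup}
    (hc : c ∈ relaxedSelmerInftyAtTwo W κ) :
    W.conjH1 2 κ.kerSubgroup τ c ∈ relaxedSelmerInftyAtTwo W κ := by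
  simp only [relaxedSelmerInftyAtTwo, AddSubgroup.mem_iInf, AddSubgroup.mem_comap] at hc ⊢
  intro v σ
  rw [← AddMonoidHom.comp_apply, ← W.conjH1_mul_holds 2 κ.kerSubgroup σ τ]
  exact hc v (σ * τ)

/-- **`Sel^{rel ∞}(ℚ_∞, E[2^∞]) ⊆ H¹(ℚ_Σ/ℚ_∞, E[2^∞])`**, `Σ = {bad} ∪ {2, ∞}`: the classical Kummer condition at a
good odd place is «unramified at that place» (Silverman AEC X.4.4, tree `localKerOver_le_unramKer`), at every
conjugate; no archimedean condition is involved. [cite: SilvermanAEC2009, Cor. X.4.4]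
[cite: GreenbergVatsal2000, §2 pp. 16–17] -/
theorem relaxedSelmerInftyAtTwo_le_unramifiedOutside :
    relaxedSelmerInftyAtTwo W κ ≤
      unramifiedOutside κ.kerSubgroup (W.geomPrimaryTorsion 2) 2 (W.badPlaces (𝓞 ℚ)) := by
  intro s hs
  rw [mem_unramifiedOutside_iff]
  intro v hv hpv σ
  simp only [relaxedSelmerInftyAtTwo, AddSubgroup.mem_iInf, AddSubgroup.mem_comap] at hs
  have hgood : W.HasGoodReductionAt v := by
    by_contra h
    exact hv h
  exact Summit.BirchSwinnertonDyer.Rank1Residual.X2.GreenbergVatsalSelmerLink.localKerOver_le_unramKer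
    (W := W) (p := 2) (H := κ.kerSubgroup) hgood hpv (hs v σ)

/-- **`Sel^{rel ∞}(ℚ_∞, E[2^∞])[𝔪]` is FINITE** for `γ` a topological generator: the set of relaxed classes killed
by `2` and fixed by `conj_γ` is finite — a subset of `H¹(ℚ_Σ/ℚ_∞, E[2^∞])[𝔪]`, finite by the tree's
`finite_setOf_unramifiedOutside_pTorsion_conjH1_eq` (Kummer lift, Silverman X.4.3, descent along `γ`).
[cite: GreenbergLNM1716, §1 p. 60 and §4 p. 117] [cite: SilvermanAEC2009, Lemma X.4.3] -/
theorem finite_setOf_relaxed_twoTorsion_conjH1_eq (hγ : κ.IsTopGenerator γ) :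
    Set.Finite {s : relaxedSelmerInftyAtTwo W κ |
      (2 : ℕ) • s = 0 ∧ W.conjH1 2 κ.kerSubgroup γ (s : W.subgroupH1 2 κ.kerSubgroup) = s} := by
  have hfin := W.finite_setOf_unramifiedOutside_pTorsion_conjH1_eq (p := 2) κ hγ
    (W.finite_badPlaces_holds (𝓞 ℚ))
  refine (hfin.preimage Subtype.val_injective.injOn).subset ?_
  rintro s ⟨hs2, hsγ⟩
  refine ⟨relaxedSelmerInftyAtTwo_le_unramifiedOutside W κ s.2, ?_, hsγ⟩
  have h1 := congrArg (fun z : relaxedSelmerInftyAtTwo W κ ↦ (z : W.subgroupH1 2 κ.kerSubgroup)) hs2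
  simpa using h1

/-! ## §2 Every pinned dual of `Sel^{rel ∞}(ℚ_∞)` is finitely generated over `Λ`; a pinned dual exists -/

/-- **Finite generation of the relaxed Selmer dual.** For `γ` a topological generator and ANY `Λ = ℤ₂⟦T⟧`-module
`Xr` pinned to `Sel^{rel ∞}(ℚ_∞, E[2^∞])` by an additive bijection `toDualR : Xr ≅ Hom(Sel^{rel ∞}, ℚ/ℤ)` under which
`T` acts as `conj_γ − 1` and the constants through `ℤ₂ → ℤ/2^k`: **`Xr` is a finitely generated `Λ`-module** — dual
Nakayama (`IwasawaDual.IsDualPair.module_finite`, Lang Ch. 5 §1) with §1's finiteness of `Sel^{rel ∞}[𝔪]`. This is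
the finite-generation datum of the archimedean receptacle of `KatoNetDataRelAtTwo` and the instance hypothesis of
`ArchKernel.one_le_lengthAt_ker_archExtension`, now DISCHARGED. [cite: Lang1990, Ch. 5 §1 (Nakayama's lemma)]
[cite: GreenbergLNM1716, §1 p. 60 (after Conj. 1.3)] -/
theorem module_finite_of_pinned (hγ : κ.IsTopGenerator γ)
    {Xr : Type*} [AddCommGroup Xr] [_root_.Module (IwasawaAlgebra 2) Xr]
    (toDualR : Xr →+ (relaxedSelmerInftyAtTwo W κ →+ AddCircle (1 : ℚ))) (hR : Function.Bijective toDualR)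
    (hT : ∀ (x : Xr) (s : relaxedSelmerInftyAtTwo W κ),
      toDualR ((PowerSeries.X : IwasawaAlgebra 2) • x) s =
        toDualR x ⟨W.conjH1 2 κ.kerSubgroup γ s, conjH1_mem_relaxedSelmerInftyAtTwo W κ γ s.2⟩ - toDualR x s)
    (hC : ∀ (c : ℤ_[2]) (x : Xr) (s : relaxedSelmerInftyAtTwo W κ) (k : ℕ), (2 ^ k) • s = 0 →
      toDualR (PowerSeries.C c • x) s = (PadicInt.toZModPow k c).val • toDualR x s) :
    Module.Finite (IwasawaAlgebra 2) Xr := by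
  -- the restricted conjugation `φ = conj_γ|` on `R = Sel^{rel ∞}`
  let φ : AddMonoid.End (relaxedSelmerInftyAtTwo W κ) :=
    AddMonoidHom.mk' (fun c ↦ ⟨W.conjH1 2 κ.kerSubgroup γ c, conjH1_mem_relaxedSelmerInftyAtTwo W κ γ c.2⟩)
      (fun a b ↦ Subtype.ext (by
        change W.conjH1 2 κ.kerSubgroup γ ((a : W.subgroupH1 2 κ.kerSubgroup) + b) =
          W.conjH1 2 κ.kerSubgroup γ a + W.conjH1 2 κ.kerSubgroup γ b
        exact map_add _ _ _))
  have hφ : ∀ s, ((φ s : relaxedSelmerInftyAtTwo W κ) : W.subgroupH1 2 κ.kerSubgroup) =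
      W.conjH1 2 κ.kerSubgroup γ s := fun _ ↦ rfl
  have h := W.isLocNil_sub_one_of_coe_eq_conjH1 κ hγ _ φ hφ
  have hpair : IwasawaDual.IsDualPair 2 (φ - 1) toDualR :=
    { bijective := hR
      T_smul := fun x s ↦ by
        rw [hT, IwasawaDual.End_sub_apply, AddMonoid.End.one_apply, map_sub]
        rfl
      C_smul := fun c x s k hk ↦ hC c x s k hk
      locNil := h }
  have hfin : (IwasawaDual.piece 2 (φ - 1) 1 : Set (relaxedSelmerInftyAtTwo W κ)).Finite := by
    refine (finite_setOf_relaxed_twoTorsion_conjH1_eq W κ hγ).subset ?_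
    intro s hs
    obtain ⟨hs1, hs2⟩ := hs
    rw [pow_one] at hs1 hs2
    rw [IwasawaDual.End_sub_apply, AddMonoid.End.one_apply, sub_eq_zero] at hs2
    refine ⟨hs1, ?_⟩
    have h2 := congrArg (fun z : relaxedSelmerInftyAtTwo W κ ↦ (z : W.subgroupH1 2 κ.kerSubgroup)) hs2
    simpa [hφ] using h2
  exact hpair.module_finite hfin

omit [W.IsElliptic] in
/-- **A pinned dual of `Sel^{rel ∞}(ℚ_∞, E[2^∞])` EXISTS** for `γ` a topological generator: the character group
`Hom(Sel^{rel ∞}(ℚ_∞), ℚ/ℤ)` with the canonical `Λ`-structure `IwasawaDual.IsLocNil.module` (`T ↦ conj_γ − 1`,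
constants through `ℤ₂ → ℤ/2^k`; every class is `2`-primary and fixed by some `conj_{γ^{2^a}}`), `toDualR = id`. So the
`Xr` of `KatoNetDataRelAtTwo` is no longer `∃`-data. [cite: GreenbergLNM1716, §1 (after Conj. 1.3)]
[cite: Washington1997, §13.2] -/
theorem exists_pinned_relaxedDual (hγ : κ.IsTopGenerator γ) :
    ∃ (Xr : Type) (_ : AddCommGroup Xr) (_ : _root_.Module (IwasawaAlgebra 2) Xr)
      (toDualR : Xr →+ (relaxedSelmerInftyAtTwo W κ →+ AddCircle (1 : ℚ))),
      Function.Bijective toDualR ∧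
      (∀ (x : Xr) (s : relaxedSelmerInftyAtTwo W κ),
        toDualR ((PowerSeries.X : IwasawaAlgebra 2) • x) s =
          toDualR x ⟨W.conjH1 2 κ.kerSubgroup γ s, conjH1_mem_relaxedSelmerInftyAtTwo W κ γ s.2⟩ - toDualR x s) ∧
      (∀ (c : ℤ_[2]) (x : Xr) (s : relaxedSelmerInftyAtTwo W κ) (k : ℕ), (2 ^ k) • s = 0 →
        toDualR (PowerSeries.C c • x) s = (PadicInt.toZModPow k c).val • toDualR x s) := by
  let φ : AddMonoid.End (relaxedSelmerInftyAtTwo W κ) :=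
    AddMonoidHom.mk' (fun c ↦ ⟨W.conjH1 2 κ.kerSubgroup γ c, conjH1_mem_relaxedSelmerInftyAtTwo W κ γ c.2⟩)
      (fun a b ↦ Subtype.ext (by
        change W.conjH1 2 κ.kerSubgroup γ ((a : W.subgroupH1 2 κ.kerSubgroup) + b) =
          W.conjH1 2 κ.kerSubgroup γ a + W.conjH1 2 κ.kerSubgroup γ b
        exact map_add _ _ _))
  have hφ : ∀ s, ((φ s : relaxedSelmerInftyAtTwo W κ) : W.subgroupH1 2 κ.kerSubgroup) =
      W.conjH1 2 κ.kerSubgroup γ s := fun _ ↦ rfl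
  have h := W.isLocNil_sub_one_of_coe_eq_conjH1 κ hγ _ φ hφ
  refine ⟨(relaxedSelmerInftyAtTwo W κ →+ AddCircle (1 : ℚ)), inferInstance, h.module, AddMonoidHom.id _,
    Function.bijective_id, fun x s ↦ ?_, fun c x s k hk ↦ ?_⟩
  · show h.smulFun PowerSeries.X x s = x _ - x s
    rw [h.smulFun_X_apply, IwasawaDual.End_sub_apply, AddMonoid.End.one_apply, map_sub]
    rfl
  · show h.smulFun (PowerSeries.C c) x s = _
    exact h.smulFun_C_apply c x hk

/-! ## §3 The archimedean extension `q : Xr ↠ D.X` for EVERY pinned `Xr` and EVERY `D : SelmerDualData` -/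

section Extension

variable {Xr : Type*} [AddCommGroup Xr] [_root_.Module (IwasawaAlgebra 2) Xr]
  (toDualR : Xr →+ (relaxedSelmerInftyAtTwo W κ →+ AddCircle (1 : ℚ)))

omit [W.IsElliptic] in
/-- **The archimedean extension EXISTS**: for `γ` a topological generator, ANY pinned dual `(Xr, toDualR)` of
`Sel^{rel ∞}(ℚ_∞, E[2^∞])` and ANY Pontryagin-dual datum `D` of `Sel_{2^∞}(E/ℚ_∞)`, there is a `Λ`-LINEAR `q : Xr → D.X`
with `D.toDual (q x) = (toDualR x)|_{Sel}` — the Pontryagin dual of the inclusion `Sel ≤ Sel^{rel ∞}`. `Λ`-linearity: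
all `Λ`-actions read through the pinnings are the canonical one (tree: `exists_linearMap_selmerDualData_surjective`
onto the canonical datum, then the comparison isomorphism `SelmerDualData.exists_linearEquiv`).
[cite: GreenbergLNM1716, §1 (after Conj. 1.3) and §4 Lemma 4.6 (PDF pp. 105–106)] -/
theorem exists_archExtension (hγ : κ.IsTopGenerator γ) (hR : Function.Bijective toDualR)
    (hT : ∀ (x : Xr) (s : relaxedSelmerInftyAtTwo W κ),
      toDualR ((PowerSeries.X : IwasawaAlgebra 2) • x) s =
        toDualR x ⟨W.conjH1 2 κ.kerSubgroup γ s, conjH1_mem_relaxedSelmerInftyAtTwo W κ γ s.2⟩ - toDualR x s)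
    (hC : ∀ (c : ℤ_[2]) (x : Xr) (s : relaxedSelmerInftyAtTwo W κ) (k : ℕ), (2 ^ k) • s = 0 →
      toDualR (PowerSeries.C c • x) s = (PadicInt.toZModPow k c).val • toDualR x s)
    (D : W.SelmerDualData κ γ) :
    ∃ q : Xr →ₗ[IwasawaAlgebra 2] D.X, ∀ (x : Xr) (s : W.selmerInfty κ),
      D.toDual (q x) s = toDualR x (AddSubgroup.inclusion (selmerInfty_le_relaxedSelmerInftyAtTwo W κ) s) := by
  obtain ⟨φ, -, hφ⟩ :=
    Summit.BirchSwinnertonDyer.BirchSwinnertonDyer.Theorems.SignedEC.H1SigmaRank.exists_linearMap_selmerDualData_surjective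
      W κ hγ (selmerInfty_le_relaxedSelmerInftyAtTwo W κ)
      (fun c hc ↦ conjH1_mem_relaxedSelmerInftyAtTwo W κ γ hc) toDualR hR hT hC
  obtain ⟨e, he⟩ := SelmerDualData.exists_linearEquiv (W.selmerDualData κ hγ) D
  refine ⟨e.toLinearMap ∘ₗ φ, fun x s ↦ ?_⟩
  rw [LinearMap.comp_apply, LinearEquiv.coe_toLinearMap, he, hφ, AddMonoidHom.comp_apply]

omit [W.IsElliptic] [_root_.Module (IwasawaAlgebra 2) Xr] in
/-- **Uniqueness of the archimedean extension**: two additive `q`'s compatible with the pinnings agree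
(`D.toDual` is injective). [folklore] -/
theorem archExtension_unique (D : W.SelmerDualData κ γ) (q q' : Xr →+ D.X)
    (hq : ∀ (x : Xr) (s : W.selmerInfty κ),
      D.toDual (q x) s = toDualR x (AddSubgroup.inclusion (selmerInfty_le_relaxedSelmerInftyAtTwo W κ) s))
    (hq' : ∀ (x : Xr) (s : W.selmerInfty κ),
      D.toDual (q' x) s = toDualR x (AddSubgroup.inclusion (selmerInfty_le_relaxedSelmerInftyAtTwo W κ) s)) :
    q = q' := by
  refine AddMonoidHom.ext fun x ↦ D.bijective.injective (AddMonoidHom.ext fun s ↦ ?_)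
  rw [hq, hq']

omit [W.IsElliptic] [_root_.Module (IwasawaAlgebra 2) Xr] in
/-- **The archimedean extension is ONTO** (`q : Xr ↠ D.X`): every character of `Sel_{2^∞}(E/ℚ_∞)` extends to
`Sel^{rel ∞}` along the injective inclusion because `ℚ/ℤ` is divisible (Baer; sibling `ArchKernel.surjective_of_compat`).
[cite: GreenbergLNM1716, §4 Lemma 4.6 (PDF p. 105)] -/
theorem archExtension_surjective (hR : Function.Bijective toDualR) (D : W.SelmerDualData κ γ) (q : Xr →+ D.X)
    (hq : ∀ (x : Xr) (s : W.selmerInfty κ),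
      D.toDual (q x) s = toDualR x (AddSubgroup.inclusion (selmerInfty_le_relaxedSelmerInftyAtTwo W κ) s)) :
    Function.Surjective q :=
  ArchKernel.surjective_of_compat (selmerInfty_le_relaxedSelmerInftyAtTwo W κ) D.toDual toDualR q D.bijective hR hq

omit [W.IsElliptic] [_root_.Module (IwasawaAlgebra 2) Xr] in
/-- **`ker q` is the Pontryagin dual of `Sel^{rel ∞}/Sel`**: `q x = 0` iff the character `toDualR x` of `Sel^{rel ∞}`
vanishes on `Sel_{2^∞}(E/ℚ_∞)` (sibling `ArchKernel.apply_eq_zero_iff`). [cite: GreenbergLNM1716, §4 Lemma 4.6 and PDF pp. 106–107] -/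
theorem archExtension_eq_zero_iff (D : W.SelmerDualData κ γ) (q : Xr →+ D.X)
    (hq : ∀ (x : Xr) (s : W.selmerInfty κ),
      D.toDual (q x) s = toDualR x (AddSubgroup.inclusion (selmerInfty_le_relaxedSelmerInftyAtTwo W κ) s))
    (x : Xr) :
    q x = 0 ↔ ∀ s : W.selmerInfty κ,
      toDualR x (AddSubgroup.inclusion (selmerInfty_le_relaxedSelmerInftyAtTwo W κ) s) = 0 :=
  ArchKernel.apply_eq_zero_iff (selmerInfty_le_relaxedSelmerInftyAtTwo W κ) D.toDual toDualR q D.bijective hq x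

omit [_root_.Module (IwasawaAlgebra 2) Xr] in
/-- **`2 · ker q = 0`** (any sign of `Δ_W`): `2 · Sel^{rel ∞} ≤ Sel` at `p = 2` (`ArchKernel.two_nsmul_mem_selmerInfty_of_mem_relaxed`),
so a character vanishing on `Sel` is killed by `2` — the kernel of the archimedean extension is a `Λ/2Λ`-module
(Greenberg's `(Λ/2)^{[Δ_E > 0]}` is the most it can be). [cite: GreenbergLNM1716, §4 Remark after Lemma 4.6 (PDF p. 106)] -/
theorem two_nsmul_eq_zero_of_archExtension_eq_zero (hR : Function.Bijective toDualR) (D : W.SelmerDualData κ γ)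
    (q : Xr →+ D.X)
    (hq : ∀ (x : Xr) (s : W.selmerInfty κ),
      D.toDual (q x) s = toDualR x (AddSubgroup.inclusion (selmerInfty_le_relaxedSelmerInftyAtTwo W κ) s))
    {x : Xr} (hx : q x = 0) : (2 : ℕ) • x = 0 :=
  ArchKernel.two_nsmul_eq_zero_of_apply_eq_zero (selmerInfty_le_relaxedSelmerInftyAtTwo W κ) D.toDual toDualR q
    D.bijective hR hq (fun r ↦ ArchKernel.two_nsmul_mem_selmerInfty_of_mem_relaxed W r) hx

/-! ## §4 The archimedean conjunct of `KatoNetDataRelAtTwo` on the receptacle: `[0 < Δ_W] ≤ ℓ₍₂₎(ker q)` -/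

omit [_root_.Module (IwasawaAlgebra 2) Xr] in
/-- **`Δ_W < 0`: the archimedean extension is BIJECTIVE** (`Sel^{rel ∞} = Sel`, `LocalArch.relaxed_eq_selmerGroupOver_of_Δ_neg`):
`X^{rel ∞}(E/ℚ_∞) ≅ X(E/ℚ_∞)` for every pinned receptacle and every datum — the `e = 0` case, unconditional.
[cite: GreenbergLNM1716, §4 (PDF p. 106: «usually this group is zero»)] -/
theorem archExtension_bijective_of_Δ_neg (hΔ : W.Δ < 0) (hR : Function.Bijective toDualR)
    (D : W.SelmerDualData κ γ) (q : Xr →+ D.X)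
    (hq : ∀ (x : Xr) (s : W.selmerInfty κ),
      D.toDual (q x) s = toDualR x (AddSubgroup.inclusion (selmerInfty_le_relaxedSelmerInftyAtTwo W κ) s)) :
    Function.Bijective q :=
  ⟨ArchKernel.archExtension_injective_of_Δ_neg W hΔ D toDualR hR q hq,
    archExtension_surjective W κ toDualR hR D q hq⟩

/-- **`Δ_W > 0`: `1 ≤ ℓ₍₂₎(ker q)` for EVERY pinned receptacle, GRANTED Greenberg's Lemma 4.6 at `2`** — the sibling
`ArchKernel.one_le_lengthAt_ker_archExtension` with its finite-generation instance hypothesis DISCHARGED by §2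
(`module_finite_of_pinned`). For `W/ℚ` globally minimal, good ordinary at `2`, `0 < Δ_W`, `κ` cyclotomic with topological
generator `γ`, `D` torsion. CONDITIONAL on the PRINT fact `Greenberg1999.lemma46_relaxed_mod_selmer_infinite_rat_two` only.
[cite: GreenbergLNM1716, §4 Lemma 4.6 and Remark (PDF pp. 105–107)] -/
theorem one_le_lengthAt_ker_archExtension' (h46 : lemma46_relaxed_mod_selmer_infinite_rat_two) [W.IsGloballyMinimal]
    (hord : IsOrdinaryAt W 2) (hΔ : 0 < W.Δ) (hκ : κ.IsCyclotomic) (hγ : κ.IsTopGenerator γ)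
    (D : W.SelmerDualData κ γ) (hD : D.IsTorsion) (hR : Function.Bijective toDualR)
    (hT : ∀ (x : Xr) (s : relaxedSelmerInftyAtTwo W κ),
      toDualR ((PowerSeries.X : IwasawaAlgebra 2) • x) s =
        toDualR x ⟨W.conjH1 2 κ.kerSubgroup γ s, conjH1_mem_relaxedSelmerInftyAtTwo W κ γ s.2⟩ - toDualR x s)
    (hC : ∀ (c : ℤ_[2]) (x : Xr) (s : relaxedSelmerInftyAtTwo W κ) (k : ℕ), (2 ^ k) • s = 0 →
      toDualR (PowerSeries.C c • x) s = (PadicInt.toZModPow k c).val • toDualR x s)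
    (q : Xr →ₗ[IwasawaAlgebra 2] D.X)
    (hq : ∀ (x : Xr) (s : W.selmerInfty κ),
      D.toDual (q x) s = toDualR x (AddSubgroup.inclusion (selmerInfty_le_relaxedSelmerInftyAtTwo W κ) s)) :
    1 ≤ lengthAt (IwasawaAlgebra 2) (LinearMap.ker q) ⟨augIdealP 2, isPrime_augIdealP_holds 2⟩ := by
  haveI : Module.Finite (IwasawaAlgebra 2) Xr := module_finite_of_pinned W κ hγ toDualR hR hT hC
  exact ArchKernel.one_le_lengthAt_ker_archExtension W h46 hord hΔ hκ hγ D hD toDualR hR q hq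

/-- **The archimedean conjunct, both signs: `([0 < Δ_W] : ℕ∞) ≤ ℓ₍₂₎(ker q)`** for every pinned receptacle and every
compatible `Λ`-linear `q` (trivial for `Δ_W < 0`; `Δ_W ≠ 0` for an elliptic curve; §4's `one_le_lengthAt_ker_archExtension'`
for `Δ_W > 0`, where alone the PRINT fact is used). [cite: GreenbergLNM1716, §4 Lemma 4.6 and Remark (PDF pp. 105–107)] -/
theorem indicator_le_lengthAt_ker_archExtension (h46 : lemma46_relaxed_mod_selmer_infinite_rat_two)
    [W.IsGloballyMinimal] (hord : IsOrdinaryAt W 2) (hκ : κ.IsCyclotomic) (hγ : κ.IsTopGenerator γ)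
    (D : W.SelmerDualData κ γ) (hD : D.IsTorsion) (hR : Function.Bijective toDualR)
    (hT : ∀ (x : Xr) (s : relaxedSelmerInftyAtTwo W κ),
      toDualR ((PowerSeries.X : IwasawaAlgebra 2) • x) s =
        toDualR x ⟨W.conjH1 2 κ.kerSubgroup γ s, conjH1_mem_relaxedSelmerInftyAtTwo W κ γ s.2⟩ - toDualR x s)
    (hC : ∀ (c : ℤ_[2]) (x : Xr) (s : relaxedSelmerInftyAtTwo W κ) (k : ℕ), (2 ^ k) • s = 0 →
      toDualR (PowerSeries.C c • x) s = (PadicInt.toZModPow k c).val • toDualR x s)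
    (q : Xr →ₗ[IwasawaAlgebra 2] D.X)
    (hq : ∀ (x : Xr) (s : W.selmerInfty κ),
      D.toDual (q x) s = toDualR x (AddSubgroup.inclusion (selmerInfty_le_relaxedSelmerInftyAtTwo W κ) s)) :
    ((if 0 < W.Δ then 1 else 0 : ℕ) : ℕ∞) ≤
      lengthAt (IwasawaAlgebra 2) (LinearMap.ker q) ⟨augIdealP 2, isPrime_augIdealP_holds 2⟩ := by
  split_ifs with hΔ
  · rw [Nat.cast_one]
    exact one_le_lengthAt_ker_archExtension' W κ toDualR h46 hord hΔ hκ hγ D hD hR hT hC q hq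
  · rw [Nat.cast_zero]
    exact zero_le

end Extension

/-- **THE ARCHIMEDEAN RECEPTACLE, PACKAGED** (the `(Xr, toDualR, q)`-part of `KatoNetDataRelAtTwo` witnessed with no
hypothesis beyond the crux binders and — for the last conjunct when `Δ_W > 0` — the PRINT fact p608868): for `W/ℚ`
globally minimal, elliptic, good ordinary at `2`, `κ` cyclotomic with topological generator `γ`, and every TORSION
Pontryagin-dual datum `D` of `Sel_{2^∞}(E/ℚ_∞)`, there are a finitely generated `Λ`-module `Xr` PINNED to
`Sel^{rel ∞}(ℚ_∞, E[2^∞])` (bijection + the two compatibilities) and a `Λ`-linear `q : Xr → D.X` dual to `Sel ≤ Sel^{rel ∞}`,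
which is ONTO and satisfies `([0 < Δ_W] : ℕ∞) ≤ ℓ₍₂₎(ker q)`. [cite: GreenbergLNM1716, §1 p. 60, §4 Lemma 4.6 and Remark (PDF pp. 105–107)]
[cite: Lang1990, Ch. 5 §1 (Nakayama's lemma)] -/
theorem exists_archReceptacle (h46 : lemma46_relaxed_mod_selmer_infinite_rat_two) [W.IsGloballyMinimal]
    (hord : IsOrdinaryAt W 2) (hκ : κ.IsCyclotomic) (hγ : κ.IsTopGenerator γ)
    (D : W.SelmerDualData κ γ) (hD : D.IsTorsion) :
    ∃ (Xr : Type) (_ : AddCommGroup Xr) (_ : _root_.Module (IwasawaAlgebra 2) Xr)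
      (toDualR : Xr →+ (relaxedSelmerInftyAtTwo W κ →+ AddCircle (1 : ℚ)))
      (q : Xr →ₗ[IwasawaAlgebra 2] D.X),
      Function.Bijective toDualR ∧
      (∀ (x : Xr) (s : relaxedSelmerInftyAtTwo W κ),
        toDualR ((PowerSeries.X : IwasawaAlgebra 2) • x) s =
          toDualR x ⟨W.conjH1 2 κ.kerSubgroup γ s, conjH1_mem_relaxedSelmerInftyAtTwo W κ γ s.2⟩ - toDualR x s) ∧
      (∀ (c : ℤ_[2]) (x : Xr) (s : relaxedSelmerInftyAtTwo W κ) (k : ℕ), (2 ^ k) • s = 0 →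
        toDualR (PowerSeries.C c • x) s = (PadicInt.toZModPow k c).val • toDualR x s) ∧
      Module.Finite (IwasawaAlgebra 2) Xr ∧
      (∀ (x : Xr) (s : W.selmerInfty κ),
        D.toDual (q x) s = toDualR x (AddSubgroup.inclusion (selmerInfty_le_relaxedSelmerInftyAtTwo W κ) s)) ∧
      Function.Surjective q ∧
      ((if 0 < W.Δ then 1 else 0 : ℕ) : ℕ∞) ≤
        lengthAt (IwasawaAlgebra 2) (LinearMap.ker q) ⟨augIdealP 2, isPrime_augIdealP_holds 2⟩ := by
  obtain ⟨Xr, _, _, toDualR, hR, hT, hC⟩ := exists_pinned_relaxedDual W κ hγ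
  obtain ⟨q, hq⟩ := exists_archExtension W κ toDualR hγ hR hT hC D
  exact ⟨Xr, inferInstance, inferInstance, toDualR, q, hR, hT, hC, module_finite_of_pinned W κ hγ toDualR hR hT hC, hq,
    archExtension_surjective W κ toDualR hR D q.toAddMonoidHom hq,
    indicator_le_lengthAt_ker_archExtension W κ toDualR h46 hord hκ hγ D hD hR hT hC q hq⟩

end Summit.BirchSwinnertonDyer.BirchSwinnertonDyer.Theorems.AlignedTransportAtTwoFineRoad.ArchReceptacle

end
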